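import Literature.AlgebraicGeometry.Resolution.WeightedCentreBottomClimb
import HarnessLib

/-!
# Weighted centres — THEOREM A⁺, the exact bottom climb for `r ≥ 3` (`E = id`)

Instrument for engine 1's `W(f)` TOY MODEL (cell `pub-rosobs`, LF-MODEL-eng1-g45 §6.2 THEOREM A⁺, case `3 ≤ r ≤ p − 1`: "`t := p + 2` if `r ≥ 3` (levels `r + 1, …, p + 1`
non-resonant; `h = id`) … `E := Φ⁻¹X′ … d = 0 if r ≥ 3`"), NOT a resolution theorem and NOT about the invariant of [AbramovichTemkinWlodarczyk2024].

* `eq_one_of_mem_level_or_fix` — (F1) termination slot by slot: a graded `k[σ]`-automorphism in `𝔄_n` all of whose slots weigh `< n` OR are fixed is the identity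
  (so `K ∩ 𝔄_{p+2} = {1}` for `K = graded ⊓ baseFixing ⊓ 𝔄_1 ⊓ fixSlots V`, `V ⊇` the slots of weight `> p + 1`);
* `eq_flow_of_three_le` — for `3 ≤ r ≤ p − 1` and the EXACT eigen-relation `s_{μ₀} x = x^{n₀}` the climb of `WeightedCentreBottomClimb` runs to level `p + 2` and gives
  `x = Φ_𝔇(σ^r)` on the nose (`EigenLift.eigen_climb_exact`).

References: [Lang2002, Ch. I §§3, 6, Ch. IV §1, Ch. V §5]; [Matsumura1987, §27]; [SerreLocalFields1979, Ch. II §4]; [AbramovichTemkinWlodarczyk2024, §5.1, Thm. 5.3.1].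
-/

namespace Literature.AlgebraicGeometry.Resolution.WeightedBlowup.BottomClimb

open Polynomial OrderFiltration LevelProjection EigenLiftLevels EigenLift TruncatedFlow ZKernel

variable {k : Type*} [CommRing k] {ι : Type*}

variable {w : ι → ℚ} {p : ℕ} [Fact p.Prime] [CharP k p] {u : ℕ → k}

omit [Fact p.Prime] [CharP k p] in
/-- **(F1) termination, slot by slot**: a graded base-fixing automorphism in `𝔄_n` each of whose slots weighs `< n` or is fixed is the identity (a datum of total weight `w i < n`
divisible by `σ^n` vanishes, `UnipotentInverse.isTW_eq_zero_of_X_pow_dvd`; bookkeeping). [cite: Lang2002, Ch. IV §1; AbramovichTemkinWlodarczyk2024, Thm. 5.3.1 (2)-(3) (p. 1578)] -/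
theorem eq_one_of_mem_level_or_fix (hw : ∀ i, 0 ≤ w i) {A : (MvPolynomial ι k)[X] ≃+* (MvPolynomial ι k)[X]} (hAg : A ∈ graded w (1 : ℚ))
    (hAb : A ∈ baseFixing) {n : ℕ} (hl : A ∈ level (X : (MvPolynomial ι k)[X]) n)
    (hV : ∀ i, w i < (n : ℚ) ∨ A (C (MvPolynomial.X i)) = C (MvPolynomial.X i)) : A = 1 :=
  eq_one_of_apply_CX hAb fun i => (hV i).elim (fun hi => by
    obtain ⟨z, hz⟩ := hl.2 (C (MvPolynomial.X i))
    have hTW : IsTW w (1 : ℚ) (w i) (A (C (MvPolynomial.X i)) - C (MvPolynomial.X i)) := by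
      rw [sub_eq_add_neg]
      exact (hAg.1.isTW_CX i).add (isTW_C (MvPolynomial.isWeightedHomogeneous_X k w i)).neg
    have h0 := UnipotentInverse.isTW_eq_zero_of_X_pow_dvd hw zero_le_one hTW ⟨z, by rw [hz, add_sub_cancel_left]⟩
      (by rw [nsmul_eq_mul, mul_one]; exact hi)
    exact sub_eq_zero.mp h0) id

/-- **THEOREM A⁺, EXACT BOTTOM CLIMB FOR `r ≥ 3`** (LF-MODEL-eng1-g45 §6.2: "`t := p + 2` if `r ≥ 3` (levels `r+1, …, p+1` non-resonant: `m − r ∈ [1, p−2]`; `h = id`) … `E = id`"): in the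
setting of `X_pow_dvd_sub_flow` with `3 ≤ r ≤ p − 1` and the EXACT eigen-relation `s_{μ₀} x = x^{n₀}` (output of `EigenLift.eigen_lift_orbit_exact`), `x = Φ_𝔇(σ^r)`, `𝔇 := π_r(x)`:
`x y = Φ_𝔇(σ^r) y` for every `y` (`K ∩ 𝔄_{p+2} = {1}` by `eq_one_of_mem_level_or_fix`; `EigenLift.eigen_climb_exact`).  Instrument for engine 1's `W(f)` toy model, NOT a resolution
theorem. [cite: Lang2002, Ch. I §§3, 6, Ch. IV §1, Ch. V §5; Matsumura1987, §27 (pp. 207–209); SerreLocalFields1979, Ch. II §4 Lemma 1; AbramovichTemkinWlodarczyk2024, §5.1 (p. 1575), Thm. 5.3.1 (2)–(3) (p. 1578)] -/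
theorem eq_flow_of_three_le (hu : ∀ n < p, (Nat.factorial n : k) * u n = 1) (hw : ∀ i, 0 ≤ w i)
    {x : (MvPolynomial ι k)[X] ≃+* (MvPolynomial ι k)[X]} (hxg : x ∈ graded w (1 : ℚ)) (hxb : x ∈ baseFixing)
    (hxV : ∀ i, (p : ℚ) + 1 < w i → x (C (MvPolynomial.X i)) = C (MvPolynomial.X i)) {r : ℕ} (hr2 : 3 ≤ r) (hrp : r ≤ p - 1)
    (hl : x ∈ level (X : (MvPolynomial ι k)[X]) r) {μ₀ : (ZMod p)ˣ} (hμ₀ : orderOf μ₀ = p - 1) {n₀ : ℕ} (hn₀ : (n₀ : ZMod p) = (μ₀ : ZMod p) ^ r)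
    (hsx : scaleConj (castUnit p μ₀) x = x ^ n₀) (y : (MvPolynomial ι k)[X]) :
    x y = flow (projDer r x) p u (C 1 * X ^ r) y := by
  have hp2 : 2 ≤ p := (Fact.out : p.Prime).two_le
  have hp1 : 1 ≤ p := by omega
  have hr1 : 1 ≤ r := by omega
  have hrp' : r < p := by omega
  have hxg1 : IsGradedHom w (1 : ℚ) (x : (MvPolynomial ι k)[X] →+* (MvPolynomial ι k)[X]) := hxg.1
  -- `𝔇 := π_r(x)` read as a derivation, and its shape
  set D := projDer r x with hDdef
  have hDX : ∀ i, MvPolynomial.IsWeightedHomogeneous w (D (MvPolynomial.X i)) (w i - r) := fun i =>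
    isWeightedHomogeneous_projDer hxg1 r i
  have hD : ∀ (a : MvPolynomial ι k) (m : ℚ), MvPolynomial.IsWeightedHomogeneous w a m →
      MvPolynomial.IsWeightedHomogeneous w (D a) (m - r) := fun a m ha => TailedLightFlow.lowers_of_X D hDX ha
  have hθ : (0 : ℚ) ≤ r := Nat.cast_nonneg r
  have hgen : ∀ i, w i < p • (r : ℚ) ∨ D (MvPolynomial.X i) = 0 := fun i => weight_lt_or_projDer_eq_zero hxV (Nat.le_of_succ_le hr2) hp2 i
  -- `Φ := Φ_𝔇(σ^r)` and the ambient `Q`-stable group `K`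
  set Φ := flowEquiv D p u hu hp1 hw hθ hD hgen (C 1 * X ^ r) with hΦdef
  set V : Set ι := {i | (p : ℚ) + 1 < w i} with hVdef
  set K : Subgroup ((MvPolynomial ι k)[X] ≃+* (MvPolynomial ι k)[X]) :=
    graded w (1 : ℚ) ⊓ baseFixing ⊓ level (X : (MvPolynomial ι k)[X]) 1 ⊓ fixSlots V with hKdef
  have hQ : ∀ μ : (ZMod p)ˣ, ∀ A ∈ K, scaleConj (castUnit p μ) A ∈ K := fun μ A hA =>
    ⟨⟨⟨scaleConj_mem_graded _ hA.1.1.2 hA.1.1.1, scaleConj_mem_baseFixing _ hA.1.1.2⟩, scaleConj_mem_level _ hA.1.1.2 hA.1.2⟩,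
      scaleConj_mem_fixSlots _ hA.2⟩
  have hK1 : K ≤ level (X : (MvPolynomial ι k)[X]) 1 := fun A hA => hA.1.2
  have hKb : K ≤ baseFixing := fun A hA => hA.1.1.2
  -- memberships of `Φ`, `x`, `h`
  have hΦb : Φ ∈ baseFixing := flowEquiv_mem_baseFixing hu hp1 hw hθ hD hgen _
  have hΦr : Φ ∈ level (X : (MvPolynomial ι k)[X]) r := flowEquiv_mem_level hu hp1 hw hθ hD hgen hrp'.le (dvd_mul_left _ _)
  have hΦ1 : Φ ∈ level (X : (MvPolynomial ι k)[X]) 1 := level_antitone _ hr1 hΦr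
  have hΦg : Φ ∈ graded w (1 : ℚ) := flowEquiv_mem_graded hu hp1 hw hθ hD hgen hr1 1
  have hΦV : Φ ∈ fixSlots V := flowEquiv_mem_fixSlots hu hp1 hw hθ hD hgen (fun v hv => projDer_X_of_V hxV r v hv) _
  have hΦK : Φ ∈ K := ⟨⟨⟨hΦg, hΦb⟩, hΦ1⟩, hΦV⟩
  have hx1 : x ∈ level (X : (MvPolynomial ι k)[X]) 1 := level_antitone _ hr1 hl
  have hxK : x ∈ K := ⟨⟨⟨hxg, hxb⟩, hx1⟩, mem_fixSlots.mpr fun i hi => hxV i hi⟩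
  -- the eigen-climb in `K`, terminal level `p + 2` (`K ∩ 𝔄_{p+2} = {1}`)
  have hres : ∀ m, r + 1 ≤ m → m < p + 2 → μ₀ ^ m ≠ μ₀ ^ r := fun m hm1 hm2 =>
    nonresonant_of_orderOf hμ₀ (by omega) (by omega)
  have ht : levelIn (X : (MvPolynomial ι k)[X]) K (p + 2) = ⊥ :=
    (Subgroup.eq_bot_iff_forall _).mpr fun A hA => Subtype.ext (eq_one_of_mem_level_or_fix hw A.2.1.1.1 A.2.1.1.2 (mem_levelIn.mp hA) fun i => by
      rcases le_or_gt (w i) ((p : ℚ) + 1) with hi | hi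
      · left
        push_cast
        linarith
      · exact Or.inr (A.2.2 i hi))
  have hΦir : Φ⁻¹ ∈ level (X : (MvPolynomial ι k)[X]) r := (level _ r).inv_mem hΦr
  have hE : (⟨Φ, hΦK⟩ : K)⁻¹ * ⟨x, hxK⟩ ∈ levelIn (X : (MvPolynomial ι k)[X]) K (r + 1) := by
    show Φ⁻¹ * x ∈ level (X : (MvPolynomial ι k)[X]) (r + 1)
    refine mem_level_succ_of_proj_eq_zero (mul_mem hΦir hl) (mul_mem (baseFixing.inv_mem hΦb) hxb) fun i => ?_
    rw [proj_mul hr1 hΦir hl, proj_inv hr1 hΦr, proj_flowEquiv hu hp1 hw hθ hD hgen hr1 hrp' 1 i, one_smul, hDdef, projDer_X,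
      neg_add_cancel]
  have hh : (1 : K) ∈ levelIn (X : (MvPolynomial ι k)[X]) K (p + 2) := Subgroup.one_mem _
  have hΦ : sConj K hQ μ₀ ⟨Φ, hΦK⟩ = ⟨Φ, hΦK⟩ ^ n₀ := Subtype.ext (by
    rw [coe_sConj, Subgroup.coe_pow]
    exact scaleConj_castUnit_flowEquiv hu hp1 hw hθ hD hgen hn₀)
  have hx : sConj K hQ μ₀ ⟨x, hxK⟩ = ⟨x, hxK⟩ ^ n₀ * 1 := Subtype.ext (by
    rw [mul_one, coe_sConj, Subgroup.coe_pow]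
    exact hsx)
  have hclimb := eigen_climb_exact hK1 hKb hQ μ₀ n₀ hn₀ (by omega : r + 1 ≤ p + 2) hres ht hE hh hΦ hx
  -- `x = Φ`
  have e : x = Φ := congrArg Subtype.val hclimb
  rw [e, hΦdef, flowEquiv_apply]

end Literature.AlgebraicGeometry.Resolution.WeightedBlowup.BottomClimb
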